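import Summits.HubbardSuperconductivity.HubbardSuperconductivity.Theorems.AnisotropyChordTransferFibre3RowCGminShells

/-!
# Route `AnisotropyChord` / H0 rotor rung: PartN41-C §2 on the t-BLOCKS — the shell and far-ring classes of the G-min bound
for `L ≥ 64`

`…Fibre3RowCGminShells` (p1 g27) bounds the classes of the GeomGMin second term `Σ_k ((4−ε_k)/(4−λ/2))^{n₀} g_λ(k)`
(`n₀ = ⌊V/3⌋`) for `L ≥ 128` using `V ≥ 16384`, `θ² ≤ 0.0025`, `ε₁ ≥ 0.9997·θ²/2`.  For the t-blocks of the range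
`48 ≤ L < 128` with floor `L₀ ≥ 64` (route-lead ruling R1; inventory memo HOME/hubbard-h0-rotor-p2/TBLOCK-INVENTORY-g8.md, item
11) this file re-derives them with the block numerics `V ≥ 4096`, `θ² ≤ 0.00964`, `ε₁ ≥ 0.9989·θ²/2`, `V/3 − 1 ≥ 0.99926·V/3`:
* `size_facts64`, `eps1_ge_sharp64`, `exp_neg_16417` (`e^{−1.6417} ≤ 0.1937`), `exp_neg_32835` (`e^{−3.2835} ≤ 0.0375`);
* ★ `shell1_le64`: `≤ 0.1937(1 + 1.784ν)/(0.9476θ²)`;  ★ `shell2_le64`: `≤ 0.0375(1 + 1.784ν)/(1.9465θ²)`;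
* ★ `far_inner_le64` (`4 ≤ |m|²`, `|mᵢ| ≤ N₁`, `8N₁ ≤ L`): SAME constants `e^{−1.52|m|²}/(0.92717θ²|m|²)`;
* ★ `far_outer_le64` (`81 ≤ |m|²`, i.e. `|m|∞ ≥ 9 > L/8` for `L ≥ 64`): `e^{−0.656|m|²}/(0.3993θ²|m|²)`.
The assembly (`torus_le_pbox64`, `pbox_G_le64`, ★ `gmin_uniform64`: `−G̃_λ(r) ≤ 0.07 + 0.1ν` for `L ≥ 64` — the SAME constant
as at `L ≥ 128`) is `…RowCGmin64`.
Prover seat `hubbard-h0-rotor-p2` g8; helper for stmt-HubbardSuperconductivity-23918 (`--supports`, helper class).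
WHAT THIS IS NOT: nothing here proves superconductivity in the Hubbard model; numeric lemmas for one L-uniform constant of ONE row
of ONE conditional reduction on the t-blocks.  Tree imports only; no new definitions; no sorry.
-/

set_option linter.dupNamespace false
set_option autoImplicit false

noncomputable section

open scoped BigOperators

namespace Summit.HubbardSuperconductivity.HubbardSuperconductivity.Theorems.AnisotropyChord.Transfer.Fibre3

namespace RowC

open RateLemma

/-! ## Block numerics -/

/-- the common size facts at `L ≥ 64`: `Vθ² = 4π²`, `V ≥ 4096`, `θ² ≤ 0.00964`. [folklore] -/
theorem size_facts64 (L : ℕ) (hL : 64 ≤ L) :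
    ((L : ℝ)) ^ 2 * (2 * Real.pi / L) ^ 2 = 4 * Real.pi ^ 2 ∧ (4096 : ℝ) ≤ ((L : ℝ)) ^ 2 ∧
      (2 * Real.pi / (L : ℝ)) ^ 2 ≤ 0.00964 := by
  have hLpos : (0 : ℝ) < L := by exact_mod_cast (show 0 < L by omega)
  have hL64 : (64 : ℝ) ≤ L := by exact_mod_cast hL
  have hπ := Real.pi_lt_d4
  have hπ0 := Real.pi_pos
  refine ⟨by field_simp; ring, by nlinarith, ?_⟩
  have : 2 * Real.pi / (L : ℝ) ≤ 0.098175 := by rw [div_le_iff₀ hLpos]; nlinarith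
  have h0 : 0 ≤ 2 * Real.pi / (L : ℝ) := by positivity
  nlinarith

/-- `ε₁ ≥ 0.9989·θ²/2` for `L ≥ 64` (`cos x ≤ 1 − x²/2 + (5/96)x⁴`, `θ² ≤ 0.00964`). [folklore] -/
theorem eps1_ge_sharp64 (L : ℕ) [NeZero L] (hL : 64 ≤ L) :
    0.9989 * ((2 * Real.pi / L) ^ 2 / 2) ≤ eps1 L := by
  have hLpos : (0 : ℝ) < L := by exact_mod_cast (show 0 < L by omega)
  have hL64 : (64 : ℝ) ≤ L := by exact_mod_cast hL
  have hπ := Real.pi_lt_d4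
  set θ : ℝ := 2 * Real.pi / L with hθ
  have hθpos : 0 < θ := by positivity
  have hθle : θ ≤ 0.098175 := by
    rw [hθ, div_le_iff₀ hLpos]; nlinarith
  have hcb := Real.cos_bound (show |θ| ≤ 1 by rw [abs_of_pos hθpos]; linarith)
  rw [abs_of_pos hθpos] at hcb
  have hc : Real.cos θ ≤ 1 - θ ^ 2 / 2 + θ ^ 4 * (5 / 96) := by
    have := (abs_le.mp hcb).2; linarith
  unfold eps1
  rw [← hθ]
  have hθ2 : θ ^ 2 ≤ 0.00964 := by nlinarith
  nlinarith [sq_nonneg θ, pow_pos hθpos 4]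

/-- `e^{−1.6417} ≤ 0.1937`. [folklore] -/
theorem exp_neg_16417 : Real.exp (-1.6417) ≤ 0.1937 := by
  have h := exp_neg_le_of_sum 1.6417 5.1627 (by norm_num) (by norm_num) 14 (by
    simp only [Finset.sum_range_succ, Finset.sum_range_zero, Nat.factorial]
    norm_num)
  exact h.trans (by norm_num)

/-- `e^{−3.2835} ≤ 0.0375`. [folklore] -/
theorem exp_neg_32835 : Real.exp (-3.2835) ≤ 0.0375 := by
  have h := exp_neg_le_of_sum 3.2835 26.667 (by norm_num) (by norm_num) 20 (by
    simp only [Finset.sum_range_succ, Finset.sum_range_zero, Nat.factorial]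
    norm_num)
  exact h.trans (by norm_num)

/-! ## The shells -/

/-- ★ SHELL 1 at `L ≥ 64` (`|m₁| + |m₂| = 1`, `ε = ε₁`). [folklore] -/
theorem shell1_le64 (L : ℕ) [NeZero L] (hL : 64 ≤ L) {lam2 ν : ℝ} (hl0 : 0 < lam2)
    (hνlam : lam2 = ν * (2 * Real.pi / L) ^ 2) (hν0 : 0 ≤ ν) (hν1 : ν ≤ 0.0513)
    (n0 : ℕ) (hn0 : ((L : ℝ)) ^ 2 / 3 - 1 ≤ n0) {k : Tor L} (hk : k ≠ 0)
    (h1 : k.1.valMinAbs.natAbs + k.2.valMinAbs.natAbs = 1) :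
    ((4 - epsT L k) / (4 - lam2 / 2)) ^ n0 * gres L lam2 k
      ≤ 0.1937 * (1 + 1.784 * ν) / (0.9476 * (2 * Real.pi / L) ^ 2) := by
  obtain ⟨hVθ, hV16, hθ2⟩ := size_facts64 L hL
  have hπ' := Real.pi_gt_d4
  have hε := eps1_ge_sharp64 L hL
  have hθpos : 0 < (2 * Real.pi / (L : ℝ)) ^ 2 := by
    have : (0 : ℝ) < L := by exact_mod_cast (show 0 < L by omega)
    positivity
  have hl1 : lam2 ≤ 1 := by rw [hνlam]; nlinarith
  have hεk : epsT L k = eps1 L := epsT_shellOne L k h1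
  have hEl : lam2 / 2 < eps1 L := by rw [hνlam]; nlinarith
  have hgt := geom_term_le L hl0 hl1 hk (eps1 L) hEl (le_of_eq hεk.symm) n0 _ hn0
  refine hgt.trans ?_
  have hnlo0 : 0 ≤ ((L : ℝ)) ^ 2 / 3 - 1 := by linarith
  -- exponent ≥ 1.6417 − 1.645ν
  have hexp : 1.6417 - 1.645 * ν ≤ (((L : ℝ)) ^ 2 / 3 - 1) * (eps1 L - lam2 / 2) / 4 := by
    have e1 : (2 * Real.pi / (L : ℝ)) ^ 2 * (0.9989 - ν) / 2 ≤ eps1 L - lam2 / 2 := by rw [hνlam]; nlinarith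
    have e2 : ((L : ℝ)) ^ 2 / 3 * 0.99926 ≤ ((L : ℝ)) ^ 2 / 3 - 1 := by nlinarith
    have e3 := mul_le_mul e2 e1 (by nlinarith) hnlo0
    have e4 : ((L : ℝ)) ^ 2 / 3 * 0.99926 * ((2 * Real.pi / (L : ℝ)) ^ 2 * (0.9989 - ν) / 2)
        = (((L : ℝ)) ^ 2 * (2 * Real.pi / L) ^ 2) * (0.99926 * (0.9989 - ν) / 6) := by ring
    rw [e4, hVθ] at e3
    have hπ2 : 9.86902 ≤ Real.pi ^ 2 := by nlinarith
    have key : 4 * 9.86902 * (0.99926 * (0.9989 - ν) / 6) ≤ 4 * Real.pi ^ 2 * (0.99926 * (0.9989 - ν) / 6) :=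
      mul_le_mul_of_nonneg_right (by linarith) (by nlinarith)
    linarith
  have hden : 0.9476 * (2 * Real.pi / (L : ℝ)) ^ 2 ≤ 2 * eps1 L - lam2 := by rw [hνlam]; nlinarith
  have hnum := exp_shell_le hexp hν0 hν1 exp_neg_16417 (by norm_num)
  exact div_le_div₀ (by positivity) hnum (by positivity) hden

/-- ★ SHELL 2 at `L ≥ 64` (`|m₁| = |m₂| = 1`, `ε = 2ε₁`). [folklore] -/
theorem shell2_le64 (L : ℕ) [NeZero L] (hL : 64 ≤ L) {lam2 ν : ℝ} (hl0 : 0 < lam2)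
    (hνlam : lam2 = ν * (2 * Real.pi / L) ^ 2) (hν0 : 0 ≤ ν) (hν1 : ν ≤ 0.0513)
    (n0 : ℕ) (hn0 : ((L : ℝ)) ^ 2 / 3 - 1 ≤ n0) {k : Tor L} (hk : k ≠ 0)
    (h2 : k.1.valMinAbs.natAbs = 1 ∧ k.2.valMinAbs.natAbs = 1) :
    ((4 - epsT L k) / (4 - lam2 / 2)) ^ n0 * gres L lam2 k
      ≤ 0.0375 * (1 + 1.784 * ν) / (1.9465 * (2 * Real.pi / L) ^ 2) := by
  obtain ⟨hVθ, hV16, hθ2⟩ := size_facts64 L hL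
  have hπ' := Real.pi_gt_d4
  have hε := eps1_ge_sharp64 L hL
  have hθpos : 0 < (2 * Real.pi / (L : ℝ)) ^ 2 := by
    have : (0 : ℝ) < L := by exact_mod_cast (show 0 < L by omega)
    positivity
  have hl1 : lam2 ≤ 1 := by rw [hνlam]; nlinarith
  have hεk : epsT L k = 2 * eps1 L := epsT_shellTwo L k h2
  have hEl : lam2 / 2 < 2 * eps1 L := by rw [hνlam]; nlinarith
  have hgt := geom_term_le L hl0 hl1 hk (2 * eps1 L) hEl (le_of_eq hεk.symm) n0 _ hn0
  refine hgt.trans ?_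
  have hnlo0 : 0 ≤ ((L : ℝ)) ^ 2 / 3 - 1 := by linarith
  have hexp : 3.2835 - 1.645 * ν ≤ (((L : ℝ)) ^ 2 / 3 - 1) * (2 * eps1 L - lam2 / 2) / 4 := by
    have e1 : (2 * Real.pi / (L : ℝ)) ^ 2 * (0.9989 - ν / 2) ≤ 2 * eps1 L - lam2 / 2 := by rw [hνlam]; nlinarith
    have e2 : ((L : ℝ)) ^ 2 / 3 * 0.99926 ≤ ((L : ℝ)) ^ 2 / 3 - 1 := by nlinarith
    have e3 := mul_le_mul e2 e1 (by nlinarith) hnlo0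
    have e4 : ((L : ℝ)) ^ 2 / 3 * 0.99926 * ((2 * Real.pi / (L : ℝ)) ^ 2 * (0.9989 - ν / 2))
        = (((L : ℝ)) ^ 2 * (2 * Real.pi / L) ^ 2) * (0.99926 * (0.9989 - ν / 2) / 3) := by ring
    rw [e4, hVθ] at e3
    have hπ2 : 9.86902 ≤ Real.pi ^ 2 := by nlinarith
    have key : 4 * 9.86902 * (0.99926 * (0.9989 - ν / 2) / 3) ≤ 4 * Real.pi ^ 2 * (0.99926 * (0.9989 - ν / 2) / 3) :=
      mul_le_mul_of_nonneg_right (by linarith) (by nlinarith)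
    linarith
  have hden : 1.9465 * (2 * Real.pi / (L : ℝ)) ^ 2 ≤ 2 * (2 * eps1 L) - lam2 := by rw [hνlam]; nlinarith
  have hnum := exp_shell_le hexp hν0 hν1 exp_neg_32835 (by norm_num)
  exact div_le_div₀ (by positivity) hnum (by positivity) hden

/-! ## The far rings -/

/-- ★ FAR, INNER REGION at `L ≥ 64` (`4 ≤ |m|²`, `|mᵢ| ≤ N₁`, `8N₁ ≤ L`): the constants `1.52`, `0.92717` of the `L ≥ 128`
lemma survive (`0.99926·9.86902·0.47·0.9863/3 ≥ 1.52`). [folklore] -/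
theorem far_inner_le64 (L : ℕ) [NeZero L] (hL : 64 ≤ L) {lam2 ν : ℝ} (hl0 : 0 < lam2)
    (hνlam : lam2 = ν * (2 * Real.pi / L) ^ 2) (hν1 : ν ≤ 0.0513)
    (n0 : ℕ) (hn0 : ((L : ℝ)) ^ 2 / 3 - 1 ≤ n0) {k : Tor L} (hk : k ≠ 0) (N₁ : ℕ) (h8 : 8 * N₁ ≤ L)
    (hin : k.1.valMinAbs.natAbs ≤ N₁ ∧ k.2.valMinAbs.natAbs ≤ N₁)
    (hq4 : (4 : ℝ) ≤ (((k.1.valMinAbs : ℤ) : ℝ)) ^ 2 + (((k.2.valMinAbs : ℤ) : ℝ)) ^ 2) :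
    ((4 - epsT L k) / (4 - lam2 / 2)) ^ n0 * gres L lam2 k
      ≤ Real.exp (-(1.52 * ((((k.1.valMinAbs : ℤ) : ℝ)) ^ 2 + (((k.2.valMinAbs : ℤ) : ℝ)) ^ 2)))
        / (0.92717 * (2 * Real.pi / L) ^ 2 * ((((k.1.valMinAbs : ℤ) : ℝ)) ^ 2 + (((k.2.valMinAbs : ℤ) : ℝ)) ^ 2)) := by
  obtain ⟨hVθ, hV16, hθ2⟩ := size_facts64 L hL
  have hπ' := Real.pi_gt_d4
  have hθpos : 0 < (2 * Real.pi / (L : ℝ)) ^ 2 := by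
    have : (0 : ℝ) < L := by exact_mod_cast (show 0 < L by omega)
    positivity
  set q : ℝ := (((k.1.valMinAbs : ℤ) : ℝ)) ^ 2 + (((k.2.valMinAbs : ℤ) : ℝ)) ^ 2 with hq
  have hl1 : lam2 ≤ 1 := by rw [hνlam]; nlinarith
  have hE := epsT_ge_inner L k N₁ h8 hin.1 hin.2
  rw [← hq] at hE
  have hEl : lam2 / 2 < 0.47 * (2 * Real.pi / (L : ℝ)) ^ 2 * q := by rw [hνlam]; nlinarith
  have hgt := geom_term_le L hl0 hl1 hk _ hEl hE n0 _ hn0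
  refine hgt.trans ?_
  have hnlo0 : 0 ≤ ((L : ℝ)) ^ 2 / 3 - 1 := by linarith
  have hexp : 1.52 * q ≤ (((L : ℝ)) ^ 2 / 3 - 1) * (0.47 * (2 * Real.pi / (L : ℝ)) ^ 2 * q - lam2 / 2) / 4 := by
    have e1 : (2 * Real.pi / (L : ℝ)) ^ 2 * (0.47 * 0.9863 * q) ≤ 0.47 * (2 * Real.pi / (L : ℝ)) ^ 2 * q - lam2 / 2 := by
      rw [hνlam]; nlinarith
    have e2 : ((L : ℝ)) ^ 2 / 3 * 0.99926 ≤ ((L : ℝ)) ^ 2 / 3 - 1 := by nlinarith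
    have e3 := mul_le_mul e2 e1 (by positivity) hnlo0
    have e4 : ((L : ℝ)) ^ 2 / 3 * 0.99926 * ((2 * Real.pi / (L : ℝ)) ^ 2 * (0.47 * 0.9863 * q))
        = (((L : ℝ)) ^ 2 * (2 * Real.pi / L) ^ 2) * (0.99926 * 0.47 * 0.9863 * q / 3) := by ring
    rw [e4, hVθ] at e3
    have hπ2 : 9.86902 ≤ Real.pi ^ 2 := by nlinarith
    have hq0 : 0 ≤ q := by linarith
    have key : 4 * 9.86902 * (0.99926 * 0.47 * 0.9863 * q / 3) ≤ 4 * Real.pi ^ 2 * (0.99926 * 0.47 * 0.9863 * q / 3) :=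
      mul_le_mul_of_nonneg_right (by linarith) (by positivity)
    linarith
  have hden : 0.92717 * (2 * Real.pi / (L : ℝ)) ^ 2 * q ≤ 2 * (0.47 * (2 * Real.pi / (L : ℝ)) ^ 2 * q) - lam2 := by
    rw [hνlam]; nlinarith
  exact div_le_div₀ (Real.exp_pos _).le (Real.exp_le_exp.mpr (by linarith)) (by positivity) hden

/-- ★ FAR, OUTER REGION at `L ≥ 64` (`81 ≤ |m|²`): `e^{−0.656|m|²}/(0.3993θ²|m|²)`. [folklore] -/
theorem far_outer_le64 (L : ℕ) [NeZero L] (hL : 64 ≤ L) {lam2 ν : ℝ} (hl0 : 0 < lam2)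
    (hνlam : lam2 = ν * (2 * Real.pi / L) ^ 2) (hν1 : ν ≤ 0.0513)
    (n0 : ℕ) (hn0 : ((L : ℝ)) ^ 2 / 3 - 1 ≤ n0) {k : Tor L} (hk : k ≠ 0)
    (hq : (81 : ℝ) ≤ (((k.1.valMinAbs : ℤ) : ℝ)) ^ 2 + (((k.2.valMinAbs : ℤ) : ℝ)) ^ 2) :
    ((4 - epsT L k) / (4 - lam2 / 2)) ^ n0 * gres L lam2 k
      ≤ Real.exp (-(0.656 * ((((k.1.valMinAbs : ℤ) : ℝ)) ^ 2 + (((k.2.valMinAbs : ℤ) : ℝ)) ^ 2)))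
        / (0.3993 * (2 * Real.pi / L) ^ 2 * ((((k.1.valMinAbs : ℤ) : ℝ)) ^ 2 + (((k.2.valMinAbs : ℤ) : ℝ)) ^ 2)) := by
  obtain ⟨hVθ, hV16, hθ2⟩ := size_facts64 L hL
  have hπ' := Real.pi_gt_d4
  have hθpos : 0 < (2 * Real.pi / (L : ℝ)) ^ 2 := by
    have : (0 : ℝ) < L := by exact_mod_cast (show 0 < L by omega)
    positivity
  set q : ℝ := (((k.1.valMinAbs : ℤ) : ℝ)) ^ 2 + (((k.2.valMinAbs : ℤ) : ℝ)) ^ 2 with hqdef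
  have hl1 : lam2 ≤ 1 := by rw [hνlam]; nlinarith
  have hE := epsT_ge_outer L k
  rw [← hqdef] at hE
  have hEl : lam2 / 2 < 0.2 * (2 * Real.pi / (L : ℝ)) ^ 2 * q := by rw [hνlam]; nlinarith
  have hgt := geom_term_le L hl0 hl1 hk _ hEl hE n0 _ hn0
  refine hgt.trans ?_
  have hnlo0 : 0 ≤ ((L : ℝ)) ^ 2 / 3 - 1 := by linarith
  have hexp : 0.656 * q ≤ (((L : ℝ)) ^ 2 / 3 - 1) * (0.2 * (2 * Real.pi / (L : ℝ)) ^ 2 * q - lam2 / 2) / 4 := by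
    have e1 : (2 * Real.pi / (L : ℝ)) ^ 2 * (0.2 * 0.9984 * q) ≤ 0.2 * (2 * Real.pi / (L : ℝ)) ^ 2 * q - lam2 / 2 := by
      rw [hνlam]; nlinarith
    have e2 : ((L : ℝ)) ^ 2 / 3 * 0.99926 ≤ ((L : ℝ)) ^ 2 / 3 - 1 := by nlinarith
    have e3 := mul_le_mul e2 e1 (by positivity) hnlo0
    have e4 : ((L : ℝ)) ^ 2 / 3 * 0.99926 * ((2 * Real.pi / (L : ℝ)) ^ 2 * (0.2 * 0.9984 * q))
        = (((L : ℝ)) ^ 2 * (2 * Real.pi / L) ^ 2) * (0.99926 * 0.2 * 0.9984 * q / 3) := by ring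
    rw [e4, hVθ] at e3
    have hπ2 : 9.86902 ≤ Real.pi ^ 2 := by nlinarith
    have hq0 : 0 ≤ q := by linarith
    have key : 4 * 9.86902 * (0.99926 * 0.2 * 0.9984 * q / 3) ≤ 4 * Real.pi ^ 2 * (0.99926 * 0.2 * 0.9984 * q / 3) :=
      mul_le_mul_of_nonneg_right (by linarith) (by positivity)
    linarith
  have hden : 0.3993 * (2 * Real.pi / (L : ℝ)) ^ 2 * q ≤ 2 * (0.2 * (2 * Real.pi / (L : ℝ)) ^ 2 * q) - lam2 := by
    rw [hνlam]; nlinarith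
  exact div_le_div₀ (Real.exp_pos _).le (Real.exp_le_exp.mpr (by linarith)) (by positivity) hden

end RowC

end Summit.HubbardSuperconductivity.HubbardSuperconductivity.Theorems.AnisotropyChord.Transfer.Fibre3

end
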